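import Summits.QuantumFields.YangMills.Theorems.CovariantDischargeFramedSweepLinCobd
import Summits.QuantumFields.YangMills.Theorems.CovariantDischargeFramedPlaquetteTransport
import HarnessLib

/-!
# Line «sandwich_discharge» on crux `HistoryTailL` (stmt-QuantumFields-19936), stub `stub_sandwichSweepGapCapped` — (R2-q):
# THE FRAMED ONE-AXIS FACTOR TO FIRST ORDER — the hypotheses `‖E − 1 − G Z G⁻¹‖ ≤ q` of (r2-M) discharged with `Z = c·ι n̂₀`, `q = 2c²`

Cell `ym3-torus` (YM ladder rung R3 = continuum SU(2) Yang–Mills on the three-torus — a RUNG, NOT the Clay problem: not d = 4, not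
infinite volume, not a mass gap), width seat `ym-ust-19936-w5` gen 14, helper letters `--supports stmt-QuantumFields-19936`.

Row (R2) of the B6 door (px8 g7 ARCH-S′ v2 §3) instantiates ✓`CovariantDischargeFramedSweepLinCobd.norm_linCobd_sub_conj_le` at the framed
one-axis factors `Eᵢ = expPoint(cᵢ • Ad_{Gᵢ} n̂₀)` with `Zᵢ := cᵢ·ι n̂₀` and «`qᵢ = O(cᵢ²)`».  THIS FILE supplies that `O(cᵢ²)` by kernel, in the
quaternion model (lit `quatMatrix`, an isometry `‖quatMatrix q‖ = ‖q‖`):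
* `coe_expPoint_eq_quatMatrix` — `↑(expPoint x) = quatMatrix (exp (ι x))`;
* ★`norm_coe_expPoint_sub_one_sub_le` — `‖↑(expPoint(c•n̂)) − 1 − quatMatrix(ι(c•n̂))‖ ≤ 2c²` (`‖n̂‖ = 1`, `|c| ≤ 1`; `= ‖(cos c − 1) + (sin c − c)·ι n̂‖`);
* ★★`norm_framedFactor_sub_le` ∕ `norm_framedFactor_inv_sub_le` — the two hypothesis shapes of (r2-M):
  `‖↑(expPoint(c • Ad_G n̂)) − 1 − ↑G·quatMatrix(ι(c•n̂))·↑G⁻¹‖ ≤ 2c²` and `‖↑(expPoint(c • Ad_G n̂))⁻¹ − 1 + ↑G·quatMatrix(ι(c•n̂))·↑G⁻¹‖ ≤ 2c²`;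
* `quatMatrix_imQuat_plaqPattern`, `norm_quatMatrix_imQuat_smul` — `Z₁+Z₂−Z₃−Z₄ = quatMatrix(ι((c₁+c₂−c₃−c₄)•n̂))`, `‖quatMatrix(ι(c•n̂))‖ = |c|`.

WHAT THIS IS NOT.  Per-factor algebra; nothing of `stub_sandwichSweepGapCapped`, `HistoryTailL`, the rung R3, d = 4 or a mass gap is proved.
YM₃ on T³ is rung R3, NOT Clay.  References: T. Bałaban, CMP **98** (1985) 17–51 [Balaban1985Averaging] ((19)–(20) p.21); CMP **122** (1989)
175–202 [Balaban1989LargeFieldI] ((1.77) p.194).  Elementary ([folklore]).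
-/

noncomputable section

open scoped Quaternion Matrix.Norms.L2Operator
open Literature.MathematicalPhysics.QuantumLattice (su2Quat quatMatrix quatMatrix_su2Quat quatMatrix_one quatMatrix_smul quatMatrix_neg norm_su2Quat)
open Literature.MathematicalPhysics.QuantumFieldTheory.Balaban1983to89
open Literature.MathematicalPhysics.QuantumFieldTheory.Balaban1983to89.T4CubeChartGnomonic (SU2)
open Literature.MathematicalPhysics.QuantumFieldTheory.Balaban1983to89.T4HaarSU2ExpChart (imQuat expPoint su2Quat_expPoint norm_imQuat)
open Literature.MathematicalPhysics.QuantumFieldTheory.Balaban1983to89.T4QuatExpLog (norm_quatMatrix quatMatrix_sub)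
open Literature.MathematicalPhysics.QuantumFieldTheory.Balaban1983to89.B15Prop1ChartSU2 (adSU2)
open Literature.Geometry.GaugeTheory (quatMatrix_add)
open Summit.QuantumFields.YangMills.Theorems.CovariantDischargeOneLinkIncrement (su2Quat_expPoint_smul)
open Summit.QuantumFields.YangMills.Theorems.CovariantDischargeFramedPlaquetteTransport (expPoint_smul_adSU2)
open Summit.QuantumFields.YangMills.Theorems.CovariantDischargeUniformFluxLetters (expPoint_neg_smul)
open Summit.QuantumFields.YangMills.Theorems.CovariantDischargeFramedSweepLinCobd (norm_conj_eq)

namespace Summit.QuantumFields.YangMills.Theorems.CovariantDischargeFramedFactorFirstOrder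

/-- The matrix of `expPoint x` is the quaternion-model matrix of `exp(ι x)`. [cite: Balaban1989LargeFieldI, (1.77) p.194] -/
theorem coe_expPoint_eq_quatMatrix (x : EuclideanSpace ℝ (Fin 3)) :
    ((expPoint x : SU2) : Matrix (Fin 2) (Fin 2) ℂ) = quatMatrix (NormedSpace.exp (imQuat x)) := by
  rw [← quatMatrix_su2Quat, su2Quat_expPoint]

/-- `|sin c − c| ≤ |c|³` for `|c| ≤ 1`. [folklore] -/
private theorem abs_sin_sub_le {c : ℝ} (hc : |c| ≤ 1) : |Real.sin c - c| ≤ |c| ^ 3 := by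
  have h := Real.sin_bound hc
  have h0 : 0 ≤ |c| := abs_nonneg c
  have h3 : 0 ≤ |c| ^ 3 := pow_nonneg h0 3
  have h5 : |c| ^ 5 ≤ |c| ^ 3 := by
    calc |c| ^ 5 = |c| ^ 3 * (|c| * |c|) := by ring
      _ ≤ |c| ^ 3 * (1 * 1) := by gcongr
      _ = |c| ^ 3 := by ring
  have e : Real.sin c - c = (Real.sin c - (c - c ^ 3 / 6)) + (-(c ^ 3 / 6)) := by ring
  rw [e]
  refine (abs_add_le _ _).trans ?_
  rw [abs_neg, abs_div, abs_of_pos (by norm_num : (0:ℝ) < 6), abs_pow]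
  linarith

/-- ★ **THE ONE-AXIS FACTOR TO FIRST ORDER**: `‖↑(expPoint(c•n̂)) − 1 − quatMatrix(ι(c•n̂))‖ ≤ 2c²` for `‖n̂‖ = 1`, `|c| ≤ 1`
(`= ‖(cos c − 1) + (sin c − c)·ι n̂‖ ≤ (1 − cos c) + |sin c − c| ≤ c²/2 + |c|³`). [cite: Balaban1985Averaging, (19)-(20) p.21] -/
theorem norm_coe_expPoint_sub_one_sub_le {n : EuclideanSpace ℝ (Fin 3)} (hn : ‖n‖ = 1) {c : ℝ} (hc : |c| ≤ 1) :
    ‖((expPoint (c • n) : SU2) : Matrix (Fin 2) (Fin 2) ℂ) - 1 - quatMatrix (imQuat (c • n))‖ ≤ 2 * c ^ 2 := by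
  rw [← quatMatrix_su2Quat, su2Quat_expPoint_smul hn, ← quatMatrix_one, ← quatMatrix_sub, ← quatMatrix_sub, norm_quatMatrix,
    map_smul]
  have e : ((Real.cos c : ℍ) + Real.sin c • imQuat n) - 1 - c • imQuat n =
      ((Real.cos c - 1 : ℝ) : ℍ) + (Real.sin c - c) • imQuat n := by
    rw [sub_smul, Quaternion.coe_sub, Quaternion.coe_one]; abel
  rw [e]
  have h1 : ‖((Real.cos c - 1 : ℝ) : ℍ)‖ = 1 - Real.cos c := by
    rw [Quaternion.norm_coe, Real.norm_eq_abs, abs_sub_comm, abs_of_nonneg (sub_nonneg.mpr (Real.cos_le_one c))]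
  have h2 : ‖(Real.sin c - c) • imQuat n‖ = |Real.sin c - c| := by
    rw [norm_smul, norm_imQuat, hn, mul_one, Real.norm_eq_abs]
  have h3 : 1 - Real.cos c ≤ c ^ 2 / 2 := by linarith [Real.one_sub_sq_div_two_le_cos (x := c)]
  have h4 : |Real.sin c - c| ≤ |c| ^ 3 := abs_sin_sub_le hc
  have h5 : |c| ^ 3 ≤ c ^ 2 := by
    have : |c| ^ 3 = c ^ 2 * |c| := by rw [pow_succ, sq_abs]
    rw [this]; nlinarith [sq_nonneg c]
  calc _ ≤ ‖((Real.cos c - 1 : ℝ) : ℍ)‖ + ‖(Real.sin c - c) • imQuat n‖ := norm_add_le _ _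
    _ ≤ 2 * c ^ 2 := by rw [h1, h2]; nlinarith [sq_nonneg c]

/-- `↑G ↑G⁻¹ = 1` for `SU2` matrices. [folklore] -/
private theorem coe_mul_coe_inv (G : SU2) : (G : Matrix (Fin 2) (Fin 2) ℂ) * ((G⁻¹ : SU2) : Matrix (Fin 2) (Fin 2) ℂ) = 1 := by
  rw [← Submonoid.coe_mul, mul_inv_cancel]; rfl

/-- ★★ **THE FRAMED FACTOR TO FIRST ORDER** (hypothesis `h₁`∕`h₂` of ✓`norm_linCobd_sub_conj_le`): for `‖n̂‖ = 1`, `|c| ≤ 1`, `G ∈ SU(2)`,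
`‖↑(expPoint(c • Ad_G n̂)) − 1 − ↑G·quatMatrix(ι(c•n̂))·↑G⁻¹‖ ≤ 2c²`. [cite: Balaban1989LargeFieldI, (1.77) p.194] -/
theorem norm_framedFactor_sub_le (G : SU2) {n : EuclideanSpace ℝ (Fin 3)} (hn : ‖n‖ = 1) {c : ℝ} (hc : |c| ≤ 1) :
    ‖((expPoint (c • adSU2 G n) : SU2) : Matrix (Fin 2) (Fin 2) ℂ) - 1 -
        (G : Matrix (Fin 2) (Fin 2) ℂ) * quatMatrix (imQuat (c • n)) * ((G⁻¹ : SU2) : Matrix (Fin 2) (Fin 2) ℂ)‖ ≤ 2 * c ^ 2 := by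
  rw [expPoint_smul_adSU2, Submonoid.coe_mul, Submonoid.coe_mul]
  have e : (G : Matrix (Fin 2) (Fin 2) ℂ) * ((expPoint (c • n) : SU2) : Matrix (Fin 2) (Fin 2) ℂ) *
        ((G⁻¹ : SU2) : Matrix (Fin 2) (Fin 2) ℂ) - 1 -
        (G : Matrix (Fin 2) (Fin 2) ℂ) * quatMatrix (imQuat (c • n)) * ((G⁻¹ : SU2) : Matrix (Fin 2) (Fin 2) ℂ) =
      (G : Matrix (Fin 2) (Fin 2) ℂ) * (((expPoint (c • n) : SU2) : Matrix (Fin 2) (Fin 2) ℂ) - 1 - quatMatrix (imQuat (c • n))) *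
        ((G⁻¹ : SU2) : Matrix (Fin 2) (Fin 2) ℂ) := by
    rw [mul_sub, sub_mul, mul_sub, sub_mul, mul_one, coe_mul_coe_inv]
  rw [e, norm_conj_eq]
  exact norm_coe_expPoint_sub_one_sub_le hn hc

/-- ★★ … and the INVERSE factor (hypothesis `h₃`∕`h₄` of ✓`norm_linCobd_sub_conj_le`):
`‖↑(expPoint(c • Ad_G n̂))⁻¹ − 1 + ↑G·quatMatrix(ι(c•n̂))·↑G⁻¹‖ ≤ 2c²`. [cite: Balaban1989LargeFieldI, (1.77) p.194] -/
theorem norm_framedFactor_inv_sub_le (G : SU2) {n : EuclideanSpace ℝ (Fin 3)} (hn : ‖n‖ = 1) {c : ℝ} (hc : |c| ≤ 1) :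
    ‖(((expPoint (c • adSU2 G n))⁻¹ : SU2) : Matrix (Fin 2) (Fin 2) ℂ) - 1 +
        (G : Matrix (Fin 2) (Fin 2) ℂ) * quatMatrix (imQuat (c • n)) * ((G⁻¹ : SU2) : Matrix (Fin 2) (Fin 2) ℂ)‖ ≤ 2 * c ^ 2 := by
  have hc' : |(-c)| ≤ 1 := by rwa [abs_neg]
  have h := norm_framedFactor_sub_le G hn hc'
  rw [expPoint_neg_smul, neg_smul, map_neg, quatMatrix_neg, mul_neg, neg_mul, sub_neg_eq_add, neg_sq] at h
  exact h

/-- The four framed first-order parts combine along the plaquette pattern: `Z₁ + Z₂ − Z₃ − Z₄ = quatMatrix(ι((c₁+c₂−c₃−c₄)•n̂))`. [folklore] -/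
theorem quatMatrix_imQuat_plaqPattern (c₁ c₂ c₃ c₄ : ℝ) (n : EuclideanSpace ℝ (Fin 3)) :
    quatMatrix (imQuat (c₁ • n)) + quatMatrix (imQuat (c₂ • n)) - quatMatrix (imQuat (c₃ • n)) - quatMatrix (imQuat (c₄ • n)) =
      quatMatrix (imQuat ((c₁ + c₂ - c₃ - c₄) • n)) := by
  rw [← quatMatrix_add, ← quatMatrix_sub, ← quatMatrix_sub, ← map_add, ← map_sub, ← map_sub, ← add_smul, ← sub_smul, ← sub_smul]

/-- `‖quatMatrix(ι(c•n̂))‖ = |c|` for `‖n̂‖ = 1` — the `‖Zᵢ‖` of (r2-M). [folklore] -/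
theorem norm_quatMatrix_imQuat_smul {n : EuclideanSpace ℝ (Fin 3)} (hn : ‖n‖ = 1) (c : ℝ) :
    ‖quatMatrix (imQuat (c • n))‖ = |c| := by
  rw [norm_quatMatrix, norm_imQuat, norm_smul, hn, mul_one, Real.norm_eq_abs]

end Summit.QuantumFields.YangMills.Theorems.CovariantDischargeFramedFactorFirstOrder

end
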